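import Literature.NumberTheory.Sieve.HeathBrownCubicLemma45
import HarnessLib

/-!
# Heath-Brown's Lemma 4.5 for higher powers: `∑_{β̂ ∈ 𝒞} τ(β)^k ≪ S₀³ (log S₀)^{c(k,A)}`

Pure-proof file in the decomposition of **Heath-Brown's Type II estimate, Lemma 3.10**
(`HeathBrown2001_lemma_3_10` of `HeathBrownCubicTypeII`), D. R. Heath-Brown, *Primes represented by
`x³ + 2y³`*, Acta Math. 186 (2001), 1–84. **Lemma 4.5** (p. 23) is printed for `τ(β)²`; its proof
("apply Lemma 4.4, with `n > (3A)⁻¹`(sic), to show that `τ(β)² ≤ max{τ(I)^{c(A)} : I ∣ β, N(I) ≪ S₀}`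
… by Lemma 4.2") works verbatim for any fixed power `τ(β)^k`, and the paper uses such variants in
§12 (p. 76: "`∑ τ(γ)⁶ ≪ xy (log x)^c`") and §13. We PROVE the `k`-th power version
(`exists_sum_latticeCube_idealDivisorCount_pow_le`): for integers `k` and `A ≥ 1` there are `C, e`
with `∑_{β̂ ∈ 𝒞} τ(β)^k ≤ C S₀³ (log S₀)^e` for every cube `𝒞 = ∏ (a_j, a_j + S₀]`, `S₀ ≥ 2`,
`max |a_j| ≤ S₀^A` (explicitly `e = 2^{4k(6A+31)+4} + 1`, from Lemma 4.4 with `n = 3A + 16`).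

## References

* D. R. Heath-Brown, *Primes represented by `x³ + 2y³`*, Acta Math. 186 (2001), 1–84: Lemma 4.5 and
  its proof, p. 23; §12 p. 76. [cite: HeathBrownActa2001, Lemma 4.5]

## Mathlib / tree search

Tree: `HeathBrownCubicLemma45` (`HeathBrown2001_lemma_4_5` for `k = 2`, `absNorm_span_coordElt_le`,
`exists_sum_idealDivisorCount_pow_div_le`, `idealDivisorCount_bot`, `card_filter_coordElt_eq_zero_le_one`),
`HeathBrownCubicLemma44` (`HeathBrown2001_lemma_4_4`), `HeathBrownCubicLatticeCount`
(`card_latticeCube_filter_mem_le'`).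
-/

noncomputable section

open Polynomial NumberField Finset

namespace Literature.NumberTheory.Sieve.CubicSieve

open LFunctions.CubeRootTwoField CubicPrimes

open scoped Classical in
/-- **Lemma 4.5 for the `k`-th power of `τ`**: for integers `k` and `A ≥ 1` there are `C > 0` and `e`
such that `∑_{β̂ ∈ 𝒞} τ(β)^k ≤ C S₀³ (log S₀)^e` for every cube `𝒞 = ∏_j (a_j, a_j + S₀]` of side
`S₀ ≥ 2` with `max |a_j| ≤ S₀^A` (the printed Lemma 4.5 is `k = 2`; same proof: Lemma 4.4 with
`n = 3A + 16`, the lattice count `#{β̂ ∈ 𝒞 : I ∣ β} ≤ 8S₀³/N(I)` and the harmonic Lemma 4.2).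
[cite: HeathBrownActa2001, Lemma 4.5] -/
theorem exists_sum_latticeCube_idealDivisorCount_pow_le (k : ℕ) {A : ℕ} (hA : 1 ≤ A) :
    ∃ C : ℝ, ∃ e : ℕ, 0 < C ∧ ∀ (a : ℝ × ℝ × ℝ) (S₀ : ℝ), 2 ≤ S₀ →
      |a.1| ≤ S₀ ^ A → |a.2.1| ≤ S₀ ^ A → |a.2.2| ≤ S₀ ^ A →
        ∑ v ∈ latticeCube a S₀, (idealDivisorCount (Ideal.span {coordElt v}) : ℝ) ^ k ≤
          C * S₀ ^ 3 * Real.log S₀ ^ e := by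
  classical
  obtain ⟨n, hn⟩ : ∃ n : ℕ, n = 3 * A + 16 := ⟨_, rfl⟩
  have hn1 : 1 ≤ n := by omega
  obtain ⟨c, hc⟩ : ∃ c : ℕ, c = k * (2 * n - 1) := ⟨_, rfl⟩
  obtain ⟨C₁, hC₁, hharm⟩ := exists_sum_idealDivisorCount_pow_div_le c
  set e : ℕ := 2 ^ (4 * c + 4) + 1 with he
  refine ⟨(1 / Real.log 2) ^ e + 2 ^ (k * (n - 1)) * (8 * C₁), e, by positivity, ?_⟩
  intro a S₀ hS₀ ha1 ha2 ha3
  have hS1 : 1 ≤ S₀ := by linarith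
  have hS0 : 0 < S₀ := by linarith
  have hlog2 : 0 < Real.log 2 := Real.log_pos one_lt_two
  have hlogS : Real.log 2 ≤ Real.log S₀ := Real.log_le_log two_pos hS₀
  have hlogS0 : 0 < Real.log S₀ := lt_of_lt_of_le hlog2 hlogS
  set N : ℕ := ⌊S₀⌋₊ with hN
  have hN2 : 2 ≤ N := Nat.le_floor (by exact_mod_cast hS₀)
  have hNS : (N : ℝ) ≤ S₀ := Nat.floor_le hS0.le
  set T := (idealsLE N).filter (· ≠ (⊥ : Ideal (𝓞 K))) with hT
  set Cube := latticeCube a S₀ with hCube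
  have hSA : S₀ ≤ S₀ ^ A := by
    calc S₀ = S₀ ^ 1 := (pow_one _).symm
      _ ≤ S₀ ^ A := pow_le_pow_right₀ hS1 hA
  have hcoord : ∀ v ∈ Cube, |(v.1 : ℝ)| + |(v.2.1 : ℝ)| + |(v.2.2 : ℝ)| ≤ 9 * S₀ ^ A := by
    intro v hv
    rw [hCube, latticeCube, mem_product, mem_product, mem_Ioc, mem_Ioc, mem_Ioc] at hv
    obtain ⟨⟨h1, h1'⟩, ⟨h2, h2'⟩, ⟨h3, h3'⟩⟩ := hv
    have side : ∀ (t : ℝ) (x : ℤ), ⌊t⌋ < x → x ≤ ⌊t + S₀⌋ → |t| ≤ S₀ ^ A →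
        |(x : ℝ)| ≤ 3 * S₀ ^ A := by
      intro t x hx hx' ht
      have e1 : (⌊t⌋ : ℝ) < x := by exact_mod_cast hx
      have e2 : (x : ℝ) ≤ ⌊t + S₀⌋ := by exact_mod_cast hx'
      have e3 : t < ⌊t⌋ + 1 := Int.lt_floor_add_one t
      have e4 : (⌊t + S₀⌋ : ℝ) ≤ t + S₀ := Int.floor_le _
      rw [abs_le] at ht ⊢
      constructor <;> linarith
    have b1 := side a.1 v.1 h1 h1' ha1
    have b2 := side a.2.1 v.2.1 h2 h2' ha2
    have b3 := side a.2.2 v.2.2 h3 h3' ha3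
    linarith
  have hnorm : ∀ v ∈ Cube, (Ideal.absNorm (Ideal.span {coordElt v}) : ℝ) ≤ S₀ ^ n := by
    intro v hv
    have h216 : (46656 : ℝ) ≤ S₀ ^ 16 := by
      calc (46656 : ℝ) ≤ 2 ^ 16 := by norm_num
        _ ≤ S₀ ^ 16 := pow_le_pow_left₀ (by norm_num) hS₀ 16
    calc (Ideal.absNorm (Ideal.span {coordElt v}) : ℝ)
        ≤ 64 * (|(v.1 : ℝ)| + |(v.2.1 : ℝ)| + |(v.2.2 : ℝ)|) ^ 3 := absNorm_span_coordElt_le v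
      _ ≤ 64 * (9 * S₀ ^ A) ^ 3 := by gcongr; exact hcoord v hv
      _ = 46656 * (S₀ ^ A) ^ 3 := by ring
      _ ≤ S₀ ^ 16 * (S₀ ^ A) ^ 3 := by gcongr
      _ = S₀ ^ n := by rw [hn]; ring
  -- Step 1: pointwise, `τ((β))^k ≤ [β = 0] + 2^{k(n-1)} ∑_{I ∈ T, β ∈ I} τ(I)^c`
  have hpt : ∀ v ∈ Cube, (idealDivisorCount (Ideal.span {coordElt v}) : ℝ) ^ k ≤
      (if coordElt v = 0 then (1 : ℝ) else 0) +
        2 ^ (k * (n - 1)) * ∑ I ∈ T.filter (fun I => coordElt v ∈ I), (idealDivisorCount I : ℝ) ^ c := by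
    intro v hv
    have hsum0 : 0 ≤ ∑ I ∈ T.filter (fun I => coordElt v ∈ I), (idealDivisorCount I : ℝ) ^ c :=
      sum_nonneg fun I _ => by positivity
    by_cases h0 : coordElt v = 0
    · rw [if_pos h0]
      have hτ1 : idealDivisorCount (Ideal.span {coordElt v}) = 1 := by
        rw [h0, Ideal.span_singleton_zero, idealDivisorCount_bot]
      rw [hτ1, Nat.cast_one, one_pow]
      have h4 : (0 : ℝ) ≤ 2 ^ (k * (n - 1)) *
          ∑ I ∈ T.filter (fun I => coordElt v ∈ I), (idealDivisorCount I : ℝ) ^ c :=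
        mul_nonneg (pow_nonneg (by norm_num) _) hsum0
      linarith
    · rw [if_neg h0, zero_add]
      have hI0 : Ideal.span {coordElt v} ≠ ⊥ := by
        rwa [Ne, Ideal.span_singleton_eq_bot]
      obtain ⟨J, hJdvd, hJnorm, hτ⟩ := HeathBrown2001_lemma_4_4 hn1 hI0
      have hJ0 : J ≠ ⊥ := by
        rintro rfl; exact hI0 (zero_dvd_iff.mp hJdvd)
      have hJS : (Ideal.absNorm J : ℝ) ≤ S₀ := by
        refine hJnorm.trans ?_
        calc (Ideal.absNorm (Ideal.span {coordElt v}) : ℝ) ^ ((n : ℝ)⁻¹)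
            ≤ (S₀ ^ n) ^ ((n : ℝ)⁻¹) :=
              Real.rpow_le_rpow (by positivity) (hnorm v hv) (by positivity)
          _ = S₀ := by
              rw [← Real.rpow_natCast, ← Real.rpow_mul hS0.le, mul_inv_cancel₀ (by positivity),
                Real.rpow_one]
      have hJN : Ideal.absNorm J ≤ N := Nat.le_floor hJS
      have hJT : J ∈ T.filter (fun I => coordElt v ∈ I) := by
        rw [mem_filter, hT, mem_filter, mem_idealsLE]
        exact ⟨⟨hJN, hJ0⟩, Ideal.dvd_span_singleton.mp hJdvd⟩
      have hτR : (idealDivisorCount (Ideal.span {coordElt v}) : ℝ) ≤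
          2 ^ (n - 1) * (idealDivisorCount J : ℝ) ^ (2 * n - 1) := by exact_mod_cast hτ
      calc (idealDivisorCount (Ideal.span {coordElt v}) : ℝ) ^ k
          ≤ (2 ^ (n - 1) * (idealDivisorCount J : ℝ) ^ (2 * n - 1)) ^ k :=
            pow_le_pow_left₀ (by positivity) hτR k
        _ = 2 ^ (k * (n - 1)) * (idealDivisorCount J : ℝ) ^ c := by
            rw [hc, mul_pow, ← pow_mul, ← pow_mul, mul_comm (n - 1) k, mul_comm (2 * n - 1) k]
        _ ≤ 2 ^ (k * (n - 1)) * ∑ I ∈ T.filter (fun I => coordElt v ∈ I), (idealDivisorCount I : ℝ) ^ c := by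
            refine mul_le_mul_of_nonneg_left ?_ (by positivity)
            exact single_le_sum (f := fun I => (idealDivisorCount I : ℝ) ^ c)
              (fun I _ => by positivity) hJT
  -- Step 2: sum over the cube and swap
  have hswap : ∑ v ∈ Cube, ∑ I ∈ T.filter (fun I => coordElt v ∈ I), (idealDivisorCount I : ℝ) ^ c =
      ∑ I ∈ T, (idealDivisorCount I : ℝ) ^ c * #(Cube.filter (fun v => coordElt v ∈ I)) := by
    simp only [sum_filter]
    rw [sum_comm]
    refine sum_congr rfl fun I _ => ?_
    rw [← sum_filter, sum_const, nsmul_eq_mul, mul_comm]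
  -- Step 3: the lattice count for `I ∈ T`
  have hcount : ∀ I ∈ T, (#(Cube.filter (fun v => coordElt v ∈ I)) : ℝ) ≤
      8 * S₀ ^ 3 / Ideal.absNorm I := by
    intro I hI
    rw [hT, mem_filter, mem_idealsLE] at hI
    have hIS : (Ideal.absNorm I : ℝ) ≤ S₀ := le_trans (by exact_mod_cast hI.1) hNS
    exact card_latticeCube_filter_mem_le' hI.2 a hIS
  -- assemble
  calc ∑ v ∈ Cube, (idealDivisorCount (Ideal.span {coordElt v}) : ℝ) ^ k
      ≤ ∑ v ∈ Cube, ((if coordElt v = 0 then (1 : ℝ) else 0) +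
          2 ^ (k * (n - 1)) * ∑ I ∈ T.filter (fun I => coordElt v ∈ I), (idealDivisorCount I : ℝ) ^ c) :=
        sum_le_sum hpt
    _ = #(Cube.filter (fun v => coordElt v = 0)) +
          2 ^ (k * (n - 1)) * ∑ I ∈ T, (idealDivisorCount I : ℝ) ^ c *
            #(Cube.filter (fun v => coordElt v ∈ I)) := by
        rw [sum_add_distrib, ← mul_sum, hswap, ← sum_filter, sum_const, nsmul_eq_mul, mul_one]
    _ ≤ 1 + 2 ^ (k * (n - 1)) * ∑ I ∈ T, (idealDivisorCount I : ℝ) ^ c * (8 * S₀ ^ 3 / Ideal.absNorm I) := by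
        gcongr with I hI
        · exact_mod_cast card_filter_coordElt_eq_zero_le_one Cube
        · exact hcount I hI
    _ = 1 + 2 ^ (k * (n - 1)) * (8 * S₀ ^ 3) *
          ∑ I ∈ T, (idealDivisorCount I : ℝ) ^ c / Ideal.absNorm I := by
        conv_rhs => rw [mul_assoc, mul_sum]
        congr 1; congr 1
        exact sum_congr rfl fun I _ => by ring
    _ ≤ 1 + 2 ^ (k * (n - 1)) * (8 * S₀ ^ 3) * (C₁ * Real.log N ^ e) := by
        gcongr
        exact hharm N hN2
    _ ≤ (1 / Real.log 2) ^ e * S₀ ^ 3 * Real.log S₀ ^ e +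
          2 ^ (k * (n - 1)) * (8 * S₀ ^ 3) * (C₁ * Real.log S₀ ^ e) := by
        have hlogN : Real.log N ≤ Real.log S₀ := Real.log_le_log (by positivity) hNS
        have hlogN0 : 0 ≤ Real.log N := Real.log_nonneg (by exact_mod_cast (show 1 ≤ N by omega))
        gcongr
        have h1 : (1 : ℝ) ≤ (1 / Real.log 2) ^ e * Real.log S₀ ^ e := by
          rw [← mul_pow]
          refine one_le_pow₀ ?_
          rw [one_div, inv_mul_eq_div, le_div_iff₀ hlog2, one_mul]
          exact hlogS
        have h3 : (1 : ℝ) ≤ S₀ ^ 3 := one_le_pow₀ hS1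
        calc (1 : ℝ) ≤ (1 / Real.log 2) ^ e * Real.log S₀ ^ e := h1
          _ ≤ (1 / Real.log 2) ^ e * Real.log S₀ ^ e * S₀ ^ 3 :=
              le_mul_of_one_le_right (by positivity) h3
          _ = (1 / Real.log 2) ^ e * S₀ ^ 3 * Real.log S₀ ^ e := by ring
    _ = ((1 / Real.log 2) ^ e + 2 ^ (k * (n - 1)) * (8 * C₁)) * S₀ ^ 3 * Real.log S₀ ^ e := by ring

open scoped Classical in
/-- The same for the cube of side `2M` centred at the origin containing the ball `|β̂|_∞ ≤ M`
(`M ≥ 1`): `∑_{|β̂_i| ≤ M} τ(β)^k ≤ C M³ (log (2M+2))^e` — the form used for "`∑_{β̂ ≪ V^{1/3}} τ(β)²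
≪ V (log X)^c`" (pp. 71, 81). [cite: HeathBrownActa2001, Lemma 4.5] -/
theorem exists_sum_box_idealDivisorCount_pow_le (k : ℕ) :
    ∃ C : ℝ, ∃ e : ℕ, 0 < C ∧ ∀ M : ℝ, 1 ≤ M →
      ∑ v ∈ (Icc (-⌊M⌋) ⌊M⌋ ×ˢ (Icc (-⌊M⌋) ⌊M⌋ ×ˢ Icc (-⌊M⌋) ⌊M⌋) : Finset (ℤ × ℤ × ℤ)),
          (idealDivisorCount (Ideal.span {coordElt v}) : ℝ) ^ k ≤
        C * M ^ 3 * Real.log (2 * M + 2) ^ e := by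
  classical
  obtain ⟨C, e, hC, h⟩ := exists_sum_latticeCube_idealDivisorCount_pow_le k (A := 1) le_rfl
  refine ⟨64 * C, e, by positivity, fun M hM => ?_⟩
  -- the box is contained in the cube `(-(⌊M⌋+1), -(⌊M⌋+1) + S₀]³`, `S₀ = 2⌊M⌋ + 2 ≤ 2M + 2`
  set m : ℤ := ⌊M⌋ with hm
  have hm0 : 0 ≤ m := Int.floor_nonneg.mpr (by linarith)
  have hmM : (m : ℝ) ≤ M := Int.floor_le M
  set S₀ : ℝ := 2 * m + 2 with hS₀
  set a : ℝ × ℝ × ℝ := (-(m : ℝ) - 1, -(m : ℝ) - 1, -(m : ℝ) - 1) with ha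
  have hm0' : (0 : ℝ) ≤ m := by exact_mod_cast hm0
  have hS2 : (2 : ℝ) ≤ S₀ := by rw [hS₀]; linarith
  have haS : |(-(m : ℝ) - 1)| ≤ S₀ ^ 1 := by
    rw [pow_one, abs_le, hS₀]
    constructor <;> linarith
  have hsub : (Icc (-m) m ×ˢ (Icc (-m) m ×ˢ Icc (-m) m) : Finset (ℤ × ℤ × ℤ)) ⊆ latticeCube a S₀ := by
    intro v hv
    simp only [mem_product, mem_Icc] at hv
    have hfl : ⌊(-(m : ℝ) - 1)⌋ = -m - 1 := by
      rw [show (-(m : ℝ) - 1) = ((-m - 1 : ℤ) : ℝ) by push_cast; ring, Int.floor_intCast]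
    have hfl2 : ⌊(-(m : ℝ) - 1 + S₀)⌋ = m + 1 := by
      rw [hS₀, show (-(m : ℝ) - 1 + (2 * m + 2)) = ((m + 1 : ℤ) : ℝ) by push_cast; ring,
        Int.floor_intCast]
    simp only [latticeCube, ha, mem_product, mem_Ioc, hfl, hfl2]
    omega
  have hmono := sum_le_sum_of_subset_of_nonneg hsub
    (f := fun v => (idealDivisorCount (Ideal.span {coordElt v}) : ℝ) ^ k) (fun v _ _ => by positivity)
  refine hmono.trans ((h a S₀ hS2 haS haS haS).trans ?_)
  have hSM : S₀ ≤ 2 * M + 2 := by rw [hS₀]; linarith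
  have hS0 : 0 < S₀ := by linarith
  have hlog0 : 0 ≤ Real.log S₀ := Real.log_nonneg (by linarith)
  have hlogle : Real.log S₀ ≤ Real.log (2 * M + 2) := Real.log_le_log hS0 hSM
  have hS3 : S₀ ^ 3 ≤ (4 * M) ^ 3 := by
    apply pow_le_pow_left₀ hS0.le; rw [hS₀]; linarith
  calc C * S₀ ^ 3 * Real.log S₀ ^ e ≤ C * (4 * M) ^ 3 * Real.log (2 * M + 2) ^ e := by gcongr
    _ = 64 * C * M ^ 3 * Real.log (2 * M + 2) ^ e := by ring

end Literature.NumberTheory.Sieve.CubicSieve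

end
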